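import Summits.QuantumFields.QCD.Theorems.RobustYangMillsRG.Negative.WildBlocking
import HarnessLib

/-!
# `RobustYangMillsRG` — negative side, part C₄: what the wild blocking map reads

Support for the disproof of the crux `RobustYangMillsRG` (stmt-QuantumFields-14958). For the wild
blocking map `bl` of part C₃ we isolate the FIRST path link: `Bl U (y,i) = U (cor y, i) · blRest`
(`blEdge_eq_first_mul_rest`), where `blRest` reads only links that are NOT first links of any
coarse edge (`blRest_congr`: interior path links by `anchor_path_ne_cor`, lasso and plaquette
links because their base sites sit at offset `−1` in direction `2` from an anchor). We also prove
the crux's LOCALITY clause (h2): `Bl U (y, i)` depends only on links based within `5 b` of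
`cor y` in every coordinate, cyclically (`bl_dependsOn_local`). Hypotheses: `M b ≤ N` (the crux's
`M = N / b`), `3 ≤ b` (`4 ≤ b` and `N / M ≤ 2 b` for (h2)). [folklore]
-/

noncomputable section

namespace Summit.QuantumFields.QCD.Theorems.RobustYangMillsRG.Negative

open MeasureTheory Complex Literature.MathematicalPhysics.QuantumFieldTheory
open Literature.MathematicalPhysics.QuantumFieldTheory.WilsonLoopRP (lineHolonomy_add lineHolonomy_congr)

variable {N M b : ℕ} [NeZero N] [NeZero M]

/-! ### First links and the remainder -/

/-- The first fine link of the straight path of the coarse edge `c = (y, i)`. [folklore] -/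
def firstEdge (N : ℕ) (c : Edge 4 M) : Edge 4 N := (cor N c.1, c.2)

omit [NeZero N] in
/-- `cor` is injective when the anchors are separated (`M b ≤ N`, `1 ≤ b`). [folklore] -/
theorem cor_injective (hMb : M * b ≤ N) (hb : 1 ≤ b) : Function.Injective (cor (M := M) N) := by
  intro y y' h
  rw [cor_eq_anchor, cor_eq_anchor] at h
  exact (anchor_inj hMb h (fun _ => by simp; omega) (fun _ => by simp; omega)).1

omit [NeZero N] in
/-- `firstEdge` is injective. [folklore] -/
theorem firstEdge_injective (hMb : M * b ≤ N) (hb : 1 ≤ b) :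
    Function.Injective (firstEdge (M := M) N) := by
  rintro ⟨y, i⟩ ⟨y', i'⟩ h
  simp only [firstEdge, Prod.mk.injEq] at h
  rw [cor_injective hMb hb h.1, h.2]

/-- The remainder of the blocking map after the first path link. [folklore] -/
def blRest (c : Edge 4 M) (U : GaugeConfig 4 N SU3) : SU3 :=
  lineHolonomy U c.2 (pathLen N c.1 c.2 - 1) ((cor N c.1).shift c.2) *
    (lasso (c.1.shift c.2) (2 + c.2) U ^ (blExp c.1 c.2 U).1 * ζ ^ (blExp c.1 c.2 U).2)

omit [NeZero N] in
/-- **`Bl U c = U (first link) · blRest c U`** (the path has positive length). [folklore] -/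
theorem blEdge_eq_first_mul_rest (hMb : M * b ≤ N) (hb : 1 ≤ b) (c : Edge 4 M)
    (U : GaugeConfig 4 N SU3) : bl U c = U (firstEdge N c) * blRest c U := by
  obtain ⟨y, i⟩ := c
  have hpos := pathLen_pos (N := N) hMb hb y i
  obtain ⟨n, hn⟩ : ∃ n, pathLen N y i = n + 1 := ⟨pathLen N y i - 1, by omega⟩
  simp only [bl, blEdge, blRest, firstEdge, hn, Nat.add_sub_cancel, lineHolonomy, mul_assoc]

/-! ### The remainder does not read first links -/

omit [NeZero N] [NeZero M] in
/-- The lasso reads only links based at sites `anchor y' o` with `o` in the lasso bounding box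
`o 2 = -1`, `-1 ≤ o c ≤ t + 2`. [folklore] -/
theorem lasso_congr (y' : Site 4 M) (t : ℕ) {U V : GaugeConfig 4 N SU3}
    (h : ∀ (o : Fin 4 → ℤ) (k : Fin 4), (o 2 = -1 ∧ ∀ c, -1 ≤ o c ∧ o c ≤ (t : ℤ) + 2) →
      U (anchor N y' o, k) = V (anchor N y' o, k)) :
    lasso y' t U = lasso y' t V := by
  have b0 : oA0 2 = -1 ∧ ∀ c, -1 ≤ oA0 c ∧ oA0 c ≤ (t : ℤ) + 2 :=
    ⟨by simp [oA0], fun c => by fin_cases c <;> simp [oA0] <;> omega⟩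
  have b1 : oA1 t 2 = -1 ∧ ∀ c, -1 ≤ oA1 t c ∧ oA1 t c ≤ (t : ℤ) + 2 :=
    ⟨by simp [oA1], fun c => by fin_cases c <;> simp [oA1] <;> omega⟩
  have b2 : oA2 t 2 = -1 ∧ ∀ c, -1 ≤ oA2 t c ∧ oA2 t c ≤ (t : ℤ) + 2 :=
    ⟨by simp [oA2], fun c => by fin_cases c <;> simp [oA2] <;> omega⟩
  have bP : oP t 2 = -1 ∧ ∀ c, -1 ≤ oP t c ∧ oP t c ≤ (t : ℤ) + 2 :=
    ⟨by simp [oP], fun c => by fin_cases c <;> simp [oP] <;> omega⟩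
  have hq0 : oP t + Pi.single 0 1 = (![2, 1, -1, (t : ℤ)] : Fin 4 → ℤ) := by
    funext i; fin_cases i <;> simp [oP]
  have hq1 : oP t + Pi.single 1 1 = (![1, 2, -1, (t : ℤ)] : Fin 4 → ℤ) := by
    funext i; fin_cases i <;> simp [oP]
  have bP0 : (![2, 1, -1, (t : ℤ)] : Fin 4 → ℤ) 2 = -1 ∧
      ∀ c, -1 ≤ (![2, 1, -1, (t : ℤ)] : Fin 4 → ℤ) c ∧ (![2, 1, -1, (t : ℤ)] : Fin 4 → ℤ) c ≤ (t : ℤ) + 2 :=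
    ⟨by simp, fun c => by fin_cases c <;> simp <;> omega⟩
  have bP1 : (![1, 2, -1, (t : ℤ)] : Fin 4 → ℤ) 2 = -1 ∧
      ∀ c, -1 ≤ (![1, 2, -1, (t : ℤ)] : Fin 4 → ℤ) c ∧ (![1, 2, -1, (t : ℤ)] : Fin 4 → ℤ) c ≤ (t : ℤ) + 2 :=
    ⟨by simp, fun c => by fin_cases c <;> simp <;> omega⟩
  have b3 : ∀ s, s < t → oA1 s 2 = -1 ∧ ∀ c, -1 ≤ oA1 s c ∧ oA1 s c ≤ (t : ℤ) + 2 := fun s hs =>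
    ⟨by simp [oA1], fun c => by fin_cases c <;> simp [oA1] <;> omega⟩
  have hT : lassoTransport y' t U = lassoTransport y' t V := by
    unfold lassoTransport
    rw [h oA0 2 b0, h (oA1 t) 0 b1, h (oA2 t) 1 b2,
      lineHolonomy_congr 3 t (anchor N y' oA0) fun s hs => ?_]
    rw [anchor_add_single, oA0_add_single_three]
    exact h _ 3 (b3 s hs)
  have hP : plaquetteHolonomy U (anchor N y' (oP t)) 0 1 =
      plaquetteHolonomy V (anchor N y' (oP t)) 0 1 := by
    simp only [plaquetteHolonomy, anchor_shift, hq0, hq1]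
    rw [h (oP t) 0 bP, h (oP t) 1 bP, h _ 1 bP0, h _ 0 bP1]
  rw [lasso, lasso, hT, hP]

omit [NeZero N] in
/-- A site at offset `−1` in direction `2` from an anchor is not an anchor (`3 ≤ b`). [folklore] -/
theorem anchor_ne_cor_of_offset (hMb : M * b ≤ N) (hb : 3 ≤ b) {y' y'' : Site 4 M}
    {o : Fin 4 → ℤ} (ho : o 2 = -1) : anchor N y' o ≠ cor N y'' := by
  intro h
  rw [cor_eq_anchor] at h
  have key := anchor_coord_inj (N := N) hMb h 2 ?_ ?_
  · have h2 := key.2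
    rw [ho] at h2
    simp at h2
  · rw [ho]; norm_num; omega
  · simp only [Pi.zero_apply, abs_zero, mul_zero]; omega

/-- **`blRest c` depends only on links that are not first links.** [folklore] -/
theorem blRest_congr (hMb : M * b ≤ N) (hb : 3 ≤ b) (c : Edge 4 M) {U V : GaugeConfig 4 N SU3}
    (h : ∀ e : Edge 4 N, e ∉ Set.range (firstEdge (M := M) N) → U e = V e) :
    blRest c U = blRest c V := by
  obtain ⟨y, i⟩ := c
  have hnot : ∀ (y' : Site 4 M) (o : Fin 4 → ℤ) (k : Fin 4), o 2 = -1 →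
      (anchor N y' o, k) ∉ Set.range (firstEdge (M := M) N) := by
    rintro y' o k ho ⟨⟨y'', i''⟩, he⟩
    simp only [firstEdge, Prod.mk.injEq] at he
    exact anchor_ne_cor_of_offset hMb hb ho he.1.symm
  have hl : ∀ (y' : Site 4 M) (t : ℕ), lasso y' t U = lasso (N := N) y' t V :=
    fun y' t => lasso_congr y' t fun o k ho => h _ (hnot y' o k ho.1)
  have hE : blExp y i U = blExp y i V := by unfold blExp; rw [hl]
  unfold blRest
  dsimp only
  rw [hl, hE, lineHolonomy_congr i _ _ fun s hs => h _ ?_]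
  -- the interior path link `cor y + (s+1) eᵢ` is not a first link
  rintro ⟨⟨y'', i''⟩, he⟩
  simp only [firstEdge, Prod.mk.injEq] at he
  have hsite : (cor N y).shift i + Pi.single i (s : ZMod N) =
      anchor N y (Pi.single i ((s + 1 : ℕ) : ℤ)) := by
    rw [WilsonLoopRP.shift_add_single, cor_eq_anchor, anchor_add_single, zero_add]
  rw [hsite] at he
  exact anchor_path_ne_cor hMb y y'' i (Nat.succ_pos s) (by omega) he.1.symm

/-! ### Locality (the crux's (h2)) -/

/-- The set of links within cyclic distance `5 b` of `cor y` in every coordinate. [folklore] -/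
def localLinks (N b : ℕ) (y : Site 4 M) : Set (Edge 4 N) :=
  {e' | ∀ c, (e'.1 c - cor N y c).val ≤ 5 * b ∨ (cor N y c - e'.1 c).val ≤ 5 * b}

omit [NeZero N] [NeZero M] in
/-- Anchored sites with offsets in `[0, 5b] ∪ {−1}` in each coordinate are local. [folklore] -/
theorem anchor_mem_localLinks (hb : 1 ≤ b) (y : Site 4 M) (o : Fin 4 → ℤ) (k : Fin 4)
    (ho : ∀ c, (0 ≤ o c ∧ o c ≤ 5 * b) ∨ o c = -1) :
    (anchor N y o, k) ∈ localLinks (M := M) N b y := by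
  intro c
  simp only [anchor, cor]
  rcases ho c with ⟨h0, h5⟩ | hneg
  · left
    obtain ⟨t, ht⟩ := Int.eq_ofNat_of_zero_le h0
    have h5' : t ≤ 5 * b := by omega
    rw [ht]
    push_cast
    rw [add_sub_cancel_left, ZMod.val_natCast]
    exact (Nat.mod_le _ _).trans h5'
  · right
    rw [hneg]
    push_cast
    rw [sub_add_cancel_left, neg_neg, ZMod.val_one_eq_one_mod]
    exact (Nat.mod_le _ _).trans (by omega)

omit [NeZero N] in
/-- Offsets of anchored sites re-based at the start anchor: `anchor (y + eᵢ) o = anchor y (L eᵢ + o)`,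
`L = pathLen y i`. [folklore] -/
theorem anchor_shift_base (y : Site 4 M) (i : Fin 4) (o : Fin 4 → ℤ) :
    anchor N (y.shift i) o = anchor N y (Pi.single i (pathLen N y i : ℤ) + o) := by
  have h := cor_shift (N := N) y i
  rw [cor_eq_anchor] at h
  funext c
  have hc := congrFun h c
  simp only [anchor, Pi.zero_apply, add_zero, Pi.add_apply] at hc ⊢
  push_cast at hc ⊢
  rw [hc]
  ring

omit [NeZero N] in
/-- **(h2) Locality of the wild blocking map**: `Bl U (y, i)` depends only on links within `5 b`
of `cor y` (given `N / M ≤ 2 b`, `4 ≤ b`). [folklore] -/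
theorem bl_dependsOn_local (hMb : M * b ≤ N) (hq : N / M ≤ 2 * b) (hb : 4 ≤ b)
    (y : Site 4 M) (i : Fin 4) : DependsOn (fun U => bl U (y, i)) (localLinks (M := M) N b y) := by
  intro U V hUV
  have hL : pathLen N y i ≤ 2 * b + 1 := (pathLen_le y i).trans (by omega)
  have hL' : b ≤ pathLen N y i := le_pathLen hMb y i
  -- lasso links at the end anchor
  have hlasso : ∀ t : ℕ, t ≤ 9 → lasso (y.shift i) t U = lasso (N := N) (y.shift i) t V := by
    intro t ht
    refine lasso_congr _ _ fun o k ho => hUV _ ?_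
    rw [anchor_shift_base]
    refine anchor_mem_localLinks (by omega) y _ k fun c => ?_
    simp only [Pi.add_apply]
    obtain ⟨h1, h2⟩ := ho.2 c
    by_cases hc : c = i
    · subst hc
      left
      simp only [Pi.single_eq_same]
      constructor <;> omega
    · simp only [Pi.single_eq_of_ne hc, zero_add]
      by_cases hm : o c = -1
      · exact Or.inr hm
      · left; constructor <;> omega
  have hE : blExp y i U = blExp y i V := by
    unfold blExp; rw [hlasso _ (by have := i.isLt; omega)]
  have hline : lineHolonomy U i (pathLen N y i) (cor N y) =
      lineHolonomy V i (pathLen N y i) (cor N y) := by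
    rw [cor_eq_anchor]
    refine lineHolonomy_congr i _ _ fun s hs => hUV _ ?_
    rw [anchor_add_single, zero_add]
    refine anchor_mem_localLinks (by omega) y _ i fun c => Or.inl ?_
    by_cases hc : c = i
    · subst hc; simp; omega
    · simp [Pi.single_eq_of_ne hc]
  change blEdge y i U = blEdge y i V
  unfold blEdge
  rw [hlasso _ (by have := i.isLt; omega), hE, hline]

end Summit.QuantumFields.QCD.Theorems.RobustYangMillsRG.Negative

end
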